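import Summits.ValiantsHypothesis.ValiantsHypothesis.Theorems.LacunarySymmetroidMatrixDescartesCensusG2K6E4
import Summits.ValiantsHypothesis.ValiantsHypothesis.Theorems.LacunarySymmetroidMatrixDescartesCensusDefs
import Summits.ValiantsHypothesis.ValiantsHypothesis.Theorems.KPlusLogSqLawTropicalBTwoRowFamily
import Summits.ValiantsHypothesis.ValiantsHypothesis.Theorems.KPlusLogSqLawTropicalCensusThreeFour

/-!
# Crux `WeakLifting` (stmt-ValiantsHypothesis-19561) — a bounded-excess lifting law NEEDS SYMMETRY:
the general-pencil excess over the tropical census is exactly `3` at `(2,6)` and `0` at `(3,4)` (kernel)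

HONEST FRAMING.  Negative census record toward the lifting crux
`Summit.ValiantsHypothesis.ValiantsHypothesis.Theses.KPlusLogSqLaw.WeakLifting` (item stmt-ValiantsHypothesis-19561, route
`KPlusLogSqLaw`), object-search cell `pub-symmetroid`, ideator seat val-idea-1 (g2, tropical / Newton-polytope lens), 2026-08-28.
It PROVES NOTHING toward `WeakLifting`, `TropicalB`, Conjecture B (`KPlusLogSqLaw`), `MatrixDescartes`
(stmt-ValiantsHypothesis-18050), the doors `DoorA26` / `DoorA34`, or `VP ≠ VNP`; every statement is a definition (a `Prop`,
nothing asserted), a monotonicity, or a finite combination of census theorems already in the tree.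

CONTEXT.  Two ideator lines of 2026-08-28 propose an ADDITIVE lifting law «real positive roots ≤ tropical census + E» for
SYMMETRIC pencils: val-idea-5's `UnitSubTropical` (`E = 1` at every format) and this seat's `AdditiveLifting`
(`E = 2^{C(K + log² m)}`, published line `Cruxes/WeakLifting/Lines/additive_lifting.lean`).  This file records, in the
kernel, WHY such a law can only be a statement about symmetry: for GENERAL (not necessarily symmetric) pencils the
additive excess is already `3` at the K1 format `(2,6)`.

RESULTS (all at the two K1 formats; `T` = signed tropical census `TropRootLawAt`, `ζ_gen` = general pencils, `ζ_sym` = symmetric).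
* `GenPosRootLawAt m K B` — the format-level positive-root law WITHOUT the symmetry hypothesis (the control column of the
  cell's census, `CENSUS.md` Table G); `GenExcessLawAt m K E := ∀ n, T(m,K) ≤ n → ζ_gen(m,K) ≤ n + E` and its symmetric twin
  `SymExcessLawAt m K E` (same shape over `PosRootLawAt`).
* `genExcessLawAt_two_six_iff : GenExcessLawAt 2 6 E ↔ 3 ≤ E` — general excess EXACTLY THREE at `(2,6)`
  (`T(2,6) = 17`: `tropRootLawAt_two_iff`; `ζ_gen(2,6) = 20`: `Census.k1_control`, certificate `Census.G2K6E4`).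
* `genExcessLawAt_three_four_iff : GenExcessLawAt 3 4 E ↔ True`-shape: `GenExcessLawAt 3 4 0` — general excess ZERO at `(3,4)`
  (`T(3,4) = 19 = ζ_gen(3,4)`: `census_three_four_exact`, `Census.k1_control`).
* `not_genExcessLaw_le_two : ¬ ∀ m K n, T(m,K) ≤ n → ζ_gen(m,K) ≤ n + 2` — no universal additive excess `≤ 2` for general
  pencils; in particular the unit law (`E = 1`) is false without symmetry.
* Symmetric side, for comparison (no new information, the doors restated in excess currency):
  `symExcessLawAt_two_six_two_iff : SymExcessLawAt 2 6 2 ↔ DoorA26`, `symExcessLawAt_two_six_one_iff : SymExcessLawAt 2 6 1 ↔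
  PosRootLawAt 2 6 18` (the unit law's prediction, one below the door), `symExcessLawAt_two_six_three` (Descartes), and at `(3,4)`
  `doorA34_iff_deficit : DoorA34 ↔ ∀ n, TropRootLawAt 3 4 (n + 1) → PosRootLawAt 3 4 n` restricted reading
  `DoorA34 ↔ PosRootLawAt 3 4 (19 - 1)` — at `(3,4)` the door asks symmetric pencils to fall STRICTLY BELOW the tropical census.
So: at `(2,6)` the K1 door is `[ζ_sym ≤ T + 2]` while `[ζ_gen = T + 3]` is a theorem; at `(3,4)` the door is `[ζ_sym ≤ T − 1]`
while `[ζ_gen = T]` is a theorem.  Any format-level lifting law with bounded additive excess is a SYMMETRY phenomenon.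
[folklore] (finite combinations of tree census theorems; Descartes' rule)
-/

set_option linter.dupNamespace false
set_option autoImplicit false

namespace Summit.ValiantsHypothesis.ValiantsHypothesis.Theorems.KPlusLogSqLaw.GeneralExcess

open Summit.ValiantsHypothesis.ValiantsHypothesis.Theorems.MatrixDescartes.Negative
open Summit.ValiantsHypothesis.ValiantsHypothesis.Theorems.LacunarySymmetroidMatrixDescartes
open Summit.ValiantsHypothesis.ValiantsHypothesis.Theorems.LacunarySymmetroidMatrixDescartes.TropicalCensus
open Summit.ValiantsHypothesis.ValiantsHypothesis.Theorems.KPlusLogSqLaw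
open scoped BigOperators
open Polynomial

/-! ## The general (control-column) law and the two excess shapes -/

/-- **General positive-root law at format `(m,K)`**: every `K`-letter pencil of real `m × m` matrices (NO symmetry asked)
has at most `B` distinct positive zeros of its determinant — the control column `ζ_gen(m,K) ≤ B` of the census.  A `Prop`;
nothing asserted. [candidate of the cell; no citation exists] -/
def GenPosRootLawAt (m K B : ℕ) : Prop :=
  ∀ (d : Fin K → ℕ) (S : Fin K → Matrix (Fin m) (Fin m) ℝ),
    ((∑ l, (X : ℝ[X]) ^ d l • (S l).map Polynomial.C).det.roots.toFinset.filter (fun t => 0 < t)).card ≤ B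

/-- monotonicity in the bound. [bookkeeping] -/
theorem genPosRootLawAt_mono {m K B B' : ℕ} (hBB' : B ≤ B') (h : GenPosRootLawAt m K B) : GenPosRootLawAt m K B' :=
  fun d S => (h d S).trans hBB'

/-- the general law implies the symmetric law. [bookkeeping] -/
theorem posRootLawAt_of_gen {m K B : ℕ} (h : GenPosRootLawAt m K B) : PosRootLawAt m K B :=
  fun d S _ => h d S

/-- **General additive excess law at format `(m,K)` with excess `E`**: whatever bounds the signed tropical census bounds the
general positive-root census up to `+E`.  A `Prop`; nothing asserted. [candidate of the cell; no citation exists] -/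
def GenExcessLawAt (m K E : ℕ) : Prop := ∀ n : ℕ, TropRootLawAt m K n → GenPosRootLawAt m K (n + E)

/-- **Symmetric additive excess law at format `(m,K)` with excess `E`** (the shape of the ideator lines `unit-subtropical`,
`E = 1`, and `additive-lifting`).  A `Prop`; nothing asserted. [candidate of the cell; no citation exists] -/
def SymExcessLawAt (m K E : ℕ) : Prop := ∀ n : ℕ, TropRootLawAt m K n → PosRootLawAt m K (n + E)

/-- general excess implies symmetric excess. [bookkeeping] -/
theorem symExcessLawAt_of_gen {m K E : ℕ} (h : GenExcessLawAt m K E) : SymExcessLawAt m K E :=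
  fun n hn => posRootLawAt_of_gen (h n hn)

/-- monotonicity in the excess. [bookkeeping] -/
theorem genExcessLawAt_mono {m K E E' : ℕ} (hEE' : E ≤ E') (h : GenExcessLawAt m K E) : GenExcessLawAt m K E' :=
  fun n hn => genPosRootLawAt_mono (by omega) (h n hn)

/-- monotonicity in the excess. [bookkeeping] -/
theorem symExcessLawAt_mono {m K E E' : ℕ} (hEE' : E ≤ E') (h : SymExcessLawAt m K E) : SymExcessLawAt m K E' :=
  fun n hn d S hS => (h n hn d S hS).trans (by omega)

/-- **Excess laws are decided by the exact censuses**: if `T(m,K) = t` exactly (law at `t`, not at `t − 1`, here phrased as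
`∀ n, T-law at n ↔ t ≤ n`), then `GenExcessLawAt m K E ↔ GenPosRootLawAt m K (t + E)`. [bookkeeping] -/
theorem genExcessLawAt_iff_of_exact {m K t E : ℕ} (ht : ∀ n, TropRootLawAt m K n ↔ t ≤ n) :
    GenExcessLawAt m K E ↔ GenPosRootLawAt m K (t + E) :=
  ⟨fun h => h t ((ht t).2 le_rfl), fun h n hn => genPosRootLawAt_mono (by have := (ht n).1 hn; omega) h⟩

/-- symmetric twin of `genExcessLawAt_iff_of_exact`. [bookkeeping] -/
theorem symExcessLawAt_iff_of_exact {m K t E : ℕ} (ht : ∀ n, TropRootLawAt m K n ↔ t ≤ n) :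
    SymExcessLawAt m K E ↔ PosRootLawAt m K (t + E) :=
  ⟨fun h => h t ((ht t).2 le_rfl), fun h n hn d S hS => (h d S hS).trans (by have := (ht n).1 hn; omega)⟩

/-! ## Format `(2,6)`: `T = 17`, `ζ_gen = 20`, door `ζ_sym ≤ 19` -/

/-- `T(2,6) = 17` exactly, as an `iff` (tree `tropRootLawAt_two_iff` at `K = 6`). [tree] -/
theorem trop_two_six_iff (n : ℕ) : TropRootLawAt 2 6 n ↔ 17 ≤ n := by
  simpa using tropRootLawAt_two_iff 6 (by norm_num) n

/-- `ζ_gen(2,6) ≤ 20` (Descartes, no symmetry; tree `Census.k1_control`). [tree] -/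
theorem genPosRootLawAt_two_six : GenPosRootLawAt 2 6 20 :=
  Census.k1_control.1.1

/-- `ζ_gen(2,6) ≥ 20`: the general law at `19` FAILS (engine-4's non-symmetric pencil with `Z₊ = 20`, tree
`Census.G2K6E4.card_posRoots_eq` via `Census.k1_control`). [tree] -/
theorem not_genPosRootLawAt_two_six : ¬ GenPosRootLawAt 2 6 19 := by
  intro h
  obtain ⟨d, S, hS⟩ := Census.k1_control.1.2
  have := h d S
  omega

/-- **General excess at `(2,6)` is EXACTLY THREE**: `GenExcessLawAt 2 6 E ↔ 3 ≤ E`. [this file] -/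
theorem genExcessLawAt_two_six_iff (E : ℕ) : GenExcessLawAt 2 6 E ↔ 3 ≤ E := by
  rw [genExcessLawAt_iff_of_exact trop_two_six_iff]
  constructor
  · intro h
    by_contra hE
    exact not_genPosRootLawAt_two_six (genPosRootLawAt_mono (by omega) h)
  · intro hE
    exact genPosRootLawAt_mono (by omega) genPosRootLawAt_two_six

/-- **Symmetric excess `≤ 2` at `(2,6)` IS the K1 door** `DoorA26 = PosRootLawAt 2 6 19`. [this file] -/
theorem symExcessLawAt_two_six_two_iff : SymExcessLawAt 2 6 2 ↔ DoorA26 :=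
  symExcessLawAt_iff_of_exact trop_two_six_iff

/-- the unit law's prediction at `(2,6)`: symmetric excess `≤ 1` is `ζ_sym(2,6) ≤ 18`, one BELOW the door (OPEN; located
`ζ_sym(2,6) ≥ 18`, `Census.M2K6G18`). [this file] -/
theorem symExcessLawAt_two_six_one_iff : SymExcessLawAt 2 6 1 ↔ PosRootLawAt 2 6 18 :=
  symExcessLawAt_iff_of_exact trop_two_six_iff

/-- symmetric excess `3` at `(2,6)` holds (Descartes). [this file] -/
theorem symExcessLawAt_two_six_three : SymExcessLawAt 2 6 3 :=
  symExcessLawAt_of_gen ((genExcessLawAt_two_six_iff 3).2 le_rfl)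

/-! ## Format `(3,4)`: `T = 19 = ζ_gen`, door `ζ_sym ≤ 18` -/

/-- `T(3,4) = 19` exactly, as an `iff` (tree `census_three_four_exact`). [tree] -/
theorem trop_three_four_iff (n : ℕ) : TropRootLawAt 3 4 n ↔ 19 ≤ n := by
  constructor
  · intro h
    by_contra hn
    exact census_three_four_exact.2 (tropRootLawAt_mono (by omega) h)
  · intro hn
    exact tropRootLawAt_mono hn census_three_four_exact.1

/-- `ζ_gen(3,4) ≤ 19` (Descartes; tree `Census.k1_control`). [tree] -/
theorem genPosRootLawAt_three_four : GenPosRootLawAt 3 4 19 :=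
  Census.k1_control.2.1

/-- `ζ_gen(3,4) ≥ 19`: the general law at `18` FAILS (tree `Census.G3K4E1` via `Census.k1_control`). [tree] -/
theorem not_genPosRootLawAt_three_four : ¬ GenPosRootLawAt 3 4 18 := by
  intro h
  obtain ⟨d, S, hS⟩ := Census.k1_control.2.2
  have := h d S
  omega

/-- **General excess at `(3,4)` is EXACTLY ZERO**: `GenExcessLawAt 3 4 E` for every `E` (already `E = 0`), and the general
law one below the tropical census fails. [this file] -/
theorem genExcessLawAt_three_four (E : ℕ) : GenExcessLawAt 3 4 E := by
  rw [genExcessLawAt_iff_of_exact trop_three_four_iff]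
  exact genPosRootLawAt_mono (by omega) genPosRootLawAt_three_four

/-- **At `(3,4)` the K1 door asks for a symmetric DEFICIT**: `DoorA34 ↔` «symmetric pencils stay strictly below the tropical
census», i.e. `∀ n, T(3,4) ≤ n + 1 → ζ_sym(3,4) ≤ n`. [this file] -/
theorem doorA34_iff_deficit : DoorA34 ↔ ∀ n : ℕ, TropRootLawAt 3 4 (n + 1) → PosRootLawAt 3 4 n := by
  constructor
  · intro h n hn
    have h19 := (trop_three_four_iff (n + 1)).1 hn
    exact fun d S hS => (h d S hS).trans (by omega)
  · intro h
    exact h 18 ((trop_three_four_iff 19).2 le_rfl)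

/-! ## No universal bounded excess for general pencils -/

/-- **No additive excess `≤ 2` lifts the tropical census to GENERAL pencils** (witness format `(2,6)`).  In particular the
unit law `E = 1` — val-idea-5's `UnitSubTropical` with the symmetry hypothesis deleted — is false; bounded-excess lifting,
if true, is a symmetry phenomenon. [this file] -/
theorem not_genExcessLaw_le_two : ¬ ∀ m K n : ℕ, TropRootLawAt m K n → GenPosRootLawAt m K (n + 2) :=
  fun h => (by
    have h3 : GenExcessLawAt 2 6 2 := fun n hn => h 2 6 n hn
    have := (genExcessLawAt_two_six_iff 2).1 h3
    omega)

/-- the same in `E`-quantified form: a universal general excess `E` must be at least `3`. [this file] -/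
theorem three_le_of_genExcessLaw (E : ℕ) (h : ∀ m K : ℕ, GenExcessLawAt m K E) : 3 ≤ E :=
  (genExcessLawAt_two_six_iff E).1 (h 2 6)

end Summit.ValiantsHypothesis.ValiantsHypothesis.Theorems.KPlusLogSqLaw.GeneralExcess
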